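/-
Copyright (c) 2026 the pub-hodgecm-mathlib formalisation cell (harness21).  Prover seat hodgecm-mathlib-LH4-p07 (g3), req620 Track A «(D-RAM) FOUR-FRAME» squad
(MS ROAD A, Stage B brick B7 (iv) «CORE-HANGING COUNT», FILE (E): the B10 SOCKET `stub_B7_H`; Stage B lead LH4-p10 (g2)).  2026-09-04.
-/
import Summits.HodgeConjecture.HodgeConjecture.Theorems.F0P3cDyRamDiagonalCoreHangingGlueCount   -- (D2) (this seat): glue heads; brings ★ (C) tube head, (D1) empties, (A), (B)
import Summits.HodgeConjecture.HodgeConjecture.Theorems.F0P3cDyRamDiagonalStrataShapes           -- ★ B3 (LH4-p04 (g2)): `dualisable_strata`, `hasAxis_latt_hnf_*`; brings ★ `hasAxis_unique`, ★ StrataDefs (`stratum`), ★ HNFExists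
import Summits.HodgeConjecture.HodgeConjecture.Theorems.F0P3cDyRamElementDatumParity             -- ★ LH4-p10 (g2): `isoceles_of_isElementDatum`, `le_min_depth_of_isElementDatum`
import Summits.HodgeConjecture.HodgeConjecture.Theorems.F0P3cDyRamGlueUnitRationalityDepth        -- ★ LH4-p08 (g2): `exists_fixed_near_glueUnit_iff_le` (the F-rationality depth of the glue unit is `n₃ − d + 1`)
import Literature.NumberTheory.LocalFields.WildQuadraticDatumTraceBound                           -- ★ p855934 (this seat): `trace_bound_of_isRamifiedQuadraticDatum` (hTr)
import Literature.NumberTheory.Automorphic.UnitaryLatticeTreeDiagonalLiteralAntidiagonalModel      -- ★ `v_eq_one_of_mul_map_eq_one` (norm one ⇒ unit)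
import HarnessLib

/-!
# Crux `H413`, MS ROAD A, STAGE B brick B7 (iv), FILE (E): THE B10 SOCKET `stub_B7_H` — the core-hanging stratum `H(2ρ)` (axis vector `(2ρ, 2ρ, 2ρ)`) contributes
# `(q−2)q^{2ρ−1}` on the tube `2ρ ≤ min nᵢ`, plus the EQUILATERAL glue `q^{2ρ−⌈(2ρ−m)∕2⌉}` iff `n₁ = n₂ = n₃ = m < 2ρ`, `2ρ − m ≤ m − d + 1`

Cell `hodgecm-mathlib` (D-0151), FLOOR 0, crux item H413 = `stmt-HodgeConjecture-24833`; lane `--supports stmt-HodgeConjecture-24833 --as helper` (count-neutral).  THEOREMS ONLY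
(no `def`, no instance, no notation, no `sorry`, default heartbeats).  HEAD = `stub_B7_H` of LH4-p10 (g2)'s B10 skeleton `F0/P3c/LH4/LH4-p10/g2/B10-StableCountTypeZero.SKELETON.v1`
(c61f53438acbd4dd :110) TOKEN FOR TOKEN in its binders `(hD : IsRamifiedQuadraticDatum σ ϖ d t) (h2 : |2| < 1) (hE : IsElementDatum σ ϖ N₀ α β n₁ n₂ n₃) (hN₀ : d ≤ N₀) (hT) (ρ) (hρ)`,
`[Fintype 𝓀[K]]`, over the DEFS ★ `stratum σ ϖ T a` (`HasAxis`).
§1 BRIDGE `stratum σ ϖ T (2ρ,2ρ,2ρ) = 𝒮_H(ρ)` (the H-frame set of ★ (C)): the H twin of F0P3-p01 (g31)'s ★ `stratum_G1_eq` — HNF model (★ `exists_latt_eq_latt_hnf`), ★ B3 `dualisable_strata`,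
the axis vectors of the eight strata (★ `hasAxis_latt_hnf_*`) against `(2ρ,2ρ,2ρ)` by ★ `hasAxis_unique` kill all but `H(ρ)`; letters `ζ := z∕ϖ^ρ`, `y″ := y − xζ`.  §2 SOCKET:
tube (★ (C)); off the tube by ★ (D1)∕(D2): `n₁ ≠ n₂` ⇒ empty (isoceles ★ `isoceles_of_isElementDatum` makes `¬(2ρ ≤ n₁ ∧ 2ρ ≤ n₂)`), `n₁ = n₂ = m < ρ` ⇒ empty, `m < 2ρ`, `n₃ ≠ m` ⇒ empty,
equilateral `m < 2ρ` ⇒ glue, the switch `2ρ − m ≤ m − d + 1` being ★ LH4-p08 `exists_fixed_near_glueUnit_iff_le` at `j = 2ρ − m` (`|g₀| = 1` equilateral, `f₀ := −f`); `hTr` ★ p855934.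
HONEST LABEL.  Count-neutral; the census laws stay PROVER TARGETS until the MS assembly lands; `HC_CM` is proved only modulo the 7 printed citations (2 remaining named inputs:
hLiu418 = `stmt-HodgeConjecture-24832`, h413 = `stmt-HodgeConjecture-24833`) until rung 0 closes.

## References
* [Kottwitz1986BaseChangeUnits] R. Kottwitz, *Base change for unit elements of Hecke algebras*, Compositio Math. 60 (1986), §1 pp. 240–241 (lattice counts via torus orbits).
* [Rogawski1990] J. D. Rogawski, *Automorphic Representations of Unitary Groups in Three Variables*, Ann. of Math. Stud. 123 (1990), §4.9 Prop. 4.9.1 (a) p. 55.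
* [Serre1980Trees] J.-P. Serre, *Trees*, Springer (1980), Ch. II §1.1 (lattices `g·𝒪^N`, Hermite normal forms).
-/

set_option autoImplicit false

noncomputable section

namespace Summit.HodgeConjecture.HodgeConjecture.Cruxes.H413.F0P3cDyRamDiagonalCoreHangingSocket

open Matrix WithZero
open Literature.NumberTheory.Automorphic Literature.NumberTheory.Automorphic.HermitianLattice
open Literature.NumberTheory.Automorphic.UnitaryLatticeTree Literature.NumberTheory.Automorphic.UnitaryThreeFourFrame
open Literature.NumberTheory.LocalFields.WildQuadraticDatum
open Summit.HodgeConjecture.HodgeConjecture.Cruxes.H413.F0P3cDyRamDiagonalTorusDefs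
open Summit.HodgeConjecture.HodgeConjecture.Cruxes.H413.F0P3cDyRamDiagonalStrataDefs
open Summit.HodgeConjecture.HodgeConjecture.Cruxes.H413.F0P3cDyRamDiagonalStableLatticeHNF
open Summit.HodgeConjecture.HodgeConjecture.Cruxes.H413.F0P3cDyRamDiagonalStableLatticeHNFExists
open Summit.HodgeConjecture.HodgeConjecture.Cruxes.H413.F0P3cDyRamDiagonalDualisableStrata
open Summit.HodgeConjecture.HodgeConjecture.Cruxes.H413.F0P3cDyRamDiagonalStrataAxis
open Summit.HodgeConjecture.HodgeConjecture.Cruxes.H413.F0P3cDyRamDiagonalStrataShapes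
open Summit.HodgeConjecture.HodgeConjecture.Cruxes.H413.F0P3cDyRamDiagonalCoreHangingCount
open Summit.HodgeConjecture.HodgeConjecture.Cruxes.H413.F0P3cDyRamDiagonalCoreHangingFoot
open Summit.HodgeConjecture.HodgeConjecture.Cruxes.H413.F0P3cDyRamDiagonalCoreHangingGlueCount
open Summit.HodgeConjecture.HodgeConjecture.Cruxes.H413.F0P3cDyRamElementDatumParity
open Summit.HodgeConjecture.HodgeConjecture.Cruxes.H413.F0P3cDyRamGlueUnitRationalityDepth
open scoped Valued WithZero Matrix MatrixGroups

variable {K : Type*} [Field K] [Valued K ℤᵐ⁰]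

/-! ## §1 The bridge: `stratum σ ϖ T (2ρ, 2ρ, 2ρ)` is the core-hanging frame set -/

/-- **(⊆) A MEMBER OF THE STRATUM `(2ρ, 2ρ, 2ρ)` IS A CORE-HANGING HNF LATTICE `H(ρ)`**: `M = (1 0 0; x ϖ^ρ 0; y z ϖ^{2ρ})·𝒪³` with `|x| = |y| = 1`, `|z| = |ϖ^ρ|`,
`|yϖ^ρ − xz| = |ϖ^ρ|` (★ HNF + ★ B3 `dualisable_strata` + ★ axis vectors + ★ `hasAxis_unique`; `ρ ≥ 1` rules out the seven other strata). [cite: Kottwitz1986BaseChangeUnits, §1 pp. 240–241] [cite: Serre1980Trees, Ch. II §1.1] -/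
theorem exists_hnf_of_mem_stratum_H {σ : K →+* K} (hvσ : ∀ a, Valued.v (σ a) = Valued.v a)
    (hfix : ∀ x : K, σ x = x → x ≠ 0 → ∃ n : ℤ, Valued.v x = WithZero.exp (2 * n)) {ϖ : K} (hϖ : Valued.v ϖ = WithZero.exp (-1 : ℤ))
    (T : GL (Fin 3) K) {ρ : ℕ} (hρ : 1 ≤ ρ) {M : Submodule 𝒪[K] (Fin 3 → K)} (hM : M ∈ stratum σ ϖ T ![2 * ρ, 2 * ρ, 2 * ρ]) :
    ∃ x y z : K, Valued.v x = 1 ∧ Valued.v y = 1 ∧ Valued.v z = Valued.v (ϖ ^ ρ) ∧ Valued.v (y * ϖ ^ ρ - x * z) = Valued.v (ϖ ^ ρ) ∧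
      M = latt (Matrix.of ![![1, 0, 0], ![x, ϖ ^ ρ, 0], ![y, z, ϖ ^ (2 * ρ)]]) ∧ M ∈ normalisedStableLattices T ∧ IsDualisableLattice σ ϖ M := by
  obtain ⟨hM0, hdual, ha⟩ := (mem_stratum_iff σ ϖ T _ M).1 hM
  have hM0' := hM0
  obtain ⟨⟨g, rfl⟩, hT, hnorm⟩ := hM0
  have hq1 : ∀ n : ℕ, Valued.v (ϖ ^ n) ≤ 1 := fun n => by
    rw [map_pow]; exact pow_le_one₀ zero_le (by rw [hϖ, ← WithZero.exp_zero, WithZero.exp_le_exp]; omega)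
  have hq_eq_one : ∀ n : ℕ, Valued.v (ϖ ^ n) = 1 → n = 0 := fun n h => by
    rw [map_pow, hϖ, ← WithZero.exp_nsmul, ← WithZero.exp_zero, WithZero.exp_inj] at h
    simp at h
    omega
  have hle : latt (g : Matrix (Fin 3) (Fin 3) K) ≤ stdLattice K 3 := fun w hw => mem_stdLattice.2 fun i => (hnorm i).1 w hw
  obtain ⟨b, c, x, y, z, hx, hy, hz, hV⟩ := exists_latt_eq_latt_hnf hϖ g hle (hnorm 0).2
  rw [hV] at hnorm hdual ha hM0' ⊢
  have hN := (normalised_latt_hnf_iff hx hy hz (hq1 b) (hq1 c)).1 hnorm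
  have hxb : 1 ≤ b → Valued.v x = 1 := fun hb => hN.1.resolve_left fun h => by have := hq_eq_one b h; omega
  have hax : ∀ {a' : Fin 3 → ℕ}, HasAxis ϖ (latt (Matrix.of ![![1, 0, 0], ![x, ϖ ^ b, 0], ![y, z, ϖ ^ c]])) a' →
      a' 0 = 2 * ρ ∧ a' 1 = 2 * ρ ∧ a' 2 = 2 * ρ := fun ha' => by
    have h := hasAxis_unique hϖ ha' ha
    rw [h]
    simp
  rcases dualisable_strata hvσ hfix hϖ b c hx hy hz hnorm hdual with
    ⟨hb, hc⟩ | ⟨s', hc, hb, -, hs2⟩ | ⟨s', hb, hc, -, hs2, hzs, hy1⟩ | ⟨s', hb, hc, -, -, hz1, hw⟩ |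
    ⟨ρ', s', hρ', hs2, h2s, hb, hc, hzρ, hy1, hw⟩ | ⟨ρ', s', hρ', hs2, h2s, hb, hc, hzρ, hy1⟩ | ⟨ρ', s', hρ', hs2, h2s, hc, hb, hzρ, hy1⟩ | ⟨ρ', hρ', hb, hc, hzρ, hy1, hw⟩
  · exfalso; subst b; subst c
    have h := (hax (hasAxis_latt_hnf_core hϖ hx hy hz)).1
    simp at h; omega
  · exfalso; subst b; subst c
    have h := (hax (hasAxis_latt_hnf_T3 hϖ s' (hxb (by omega)) hy hz)).2.2
    simp at h; omega
  · exfalso; subst b; subst c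
    have h := (hax (hasAxis_latt_hnf_T2 hϖ (by omega) hx hzs hy1)).2.1
    simp at h; omega
  · exfalso; subst b; subst c
    have h := (hax (hasAxis_latt_hnf_T1 hϖ s' hx hz1 hw)).1
    simp at h; omega
  · exfalso; subst b; subst c
    obtain ⟨h0, h1, -⟩ := hax (hasAxis_latt_hnf_G1 hϖ ρ' s' (hxb hρ') hzρ hw)
    simp at h0 h1; omega
  · exfalso; subst b; subst c
    obtain ⟨h0, h1, -⟩ := hax (hasAxis_latt_hnf_G2 hϖ ρ' (by omega) (hxb hρ') hy1 hzρ)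
    simp at h0 h1; omega
  · exfalso; subst b; subst c
    obtain ⟨h0, -, h2⟩ := hax (hasAxis_latt_hnf_G3 hϖ ρ' (by omega) (hxb (by omega)) hy1 hzρ)
    simp at h0 h2; omega
  · -- THE core-hanging stratum: `ρ' = ρ`
    subst b; subst c
    obtain ⟨h0, -, -⟩ := hax (hasAxis_latt_hnf_H hϖ ρ' (hxb hρ') hzρ hw)
    simp at h0
    have hρρ : ρ' = ρ := by omega
    subst hρρ
    exact ⟨x, y, z, hxb hρ', hy1, hzρ, hw, rfl, hM0', hdual⟩

/-- **THE STRATUM `(2ρ, 2ρ, 2ρ)` IS THE CORE-HANGING FRAME SET** `𝒮_H(ρ)` of ★ (C) (`ρ ≥ 1`, any `T`): letters `ζ = z∕ϖ^ρ`, `y″ = y − xζ` (units, with `|xζ + y″| = |y| = 1`);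
conversely ★ `hasAxis_latt_hnf_H`. [cite: Kottwitz1986BaseChangeUnits, §1 pp. 240–241] [cite: Serre1980Trees, Ch. II §1.1] -/
theorem stratum_H_eq {σ : K →+* K} (hvσ : ∀ a, Valued.v (σ a) = Valued.v a)
    (hfix : ∀ x : K, σ x = x → x ≠ 0 → ∃ n : ℤ, Valued.v x = WithZero.exp (2 * n)) {ϖ : K} (hϖ : Valued.v ϖ = WithZero.exp (-1 : ℤ))
    (T : GL (Fin 3) K) {ρ : ℕ} (hρ : 1 ≤ ρ) :
    stratum σ ϖ T ![2 * ρ, 2 * ρ, 2 * ρ] =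
      {M : Submodule 𝒪[K] (Fin 3 → K) | M ∈ normalisedStableLattices T ∧ IsDualisableLattice σ ϖ M ∧
        ∃ x ζ y'' : K, Valued.v x = 1 ∧ Valued.v ζ = 1 ∧ Valued.v y'' = 1 ∧ Valued.v (x * ζ + y'') = 1 ∧
          M = latt (!![1, 0, 0; x, ϖ ^ ρ, 0; x * ζ + y'', ϖ ^ ρ * ζ, ϖ ^ (2 * ρ)] : Matrix (Fin 3) (Fin 3) K)} := by
  have hϖ0 : ϖ ≠ 0 := (Valuation.ne_zero_iff Valued.v).1 (by rw [hϖ]; exact WithZero.exp_ne_zero)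
  have hvϖ : 0 < Valued.v ϖ := (Valuation.pos_iff _).2 hϖ0
  have hpρ : Valued.v (ϖ ^ ρ) ≠ 0 := by rw [map_pow]; exact pow_ne_zero _ hvϖ.ne'
  ext M
  constructor
  · intro hM
    obtain ⟨x, y, z, hx1, hy1, hzρ, hw, rfl, hM0, hdual⟩ := exists_hnf_of_mem_stratum_H hvσ hfix hϖ T hρ hM
    set ζ : K := z * (ϖ ^ ρ)⁻¹ with hζdef
    set y'' : K := y - x * ζ with hy''def
    have hzeq : ϖ ^ ρ * ζ = z := by rw [hζdef]; field_simp
    have hyeq : x * ζ + y'' = y := by rw [hy''def]; ring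
    have hζ : Valued.v ζ = 1 := by rw [hζdef, map_mul, map_inv₀, hzρ, mul_inv_cancel₀ hpρ]
    have hy'' : Valued.v y'' = 1 := by
      have e : y'' = (y * ϖ ^ ρ - x * z) * (ϖ ^ ρ)⁻¹ := by rw [hy''def, hζdef]; field_simp
      rw [e, map_mul, map_inv₀, hw, mul_inv_cancel₀ hpρ]
    refine ⟨hM0, hdual, x, ζ, y'', hx1, hζ, hy'', by rw [hyeq]; exact hy1, ?_⟩
    rw [hyeq, hzeq]
  · rintro ⟨hM0, hdual, x, ζ, y'', hx1, hζ, hy'', hy, rfl⟩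
    have hz : Valued.v (ϖ ^ ρ * ζ) = Valued.v (ϖ ^ ρ) := by rw [map_mul, hζ, mul_one]
    have hw : Valued.v ((x * ζ + y'') * ϖ ^ ρ - x * (ϖ ^ ρ * ζ)) = Valued.v (ϖ ^ ρ) := by
      rw [show (x * ζ + y'') * ϖ ^ ρ - x * (ϖ ^ ρ * ζ) = y'' * ϖ ^ ρ by ring, map_mul, hy'', one_mul]
    exact (mem_stratum_iff σ ϖ T _ _).2 ⟨hM0, hdual, hasAxis_latt_hnf_H hϖ ρ hx1 hz hw⟩

/-! ## §2 The socket `stub_B7_H` -/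

section Socket

variable {K : Type} [Field K] [Valued K ℤᵐ⁰] [Fintype 𝓀[K]] {σ : K →+* K} {ϖ : K} {d t : ℕ} {α β : K} {N₀ n₁ n₂ n₃ : ℕ} {T : GL (Fin 3) K}

/-- **B7 · `stub_B7_H` — THE CORE-HANGING STRATUM `H(2ρ)`** (B10 skeleton c61f53438acbd4dd :110, TOKEN FOR TOKEN): axis `(2ρ, 2ρ, 2ρ)`, `ρ ≥ 1`: the weighted count is
`(q−2)q^{2ρ−1}` iff `2ρ ≤ min(n₁, n₂, n₃)`, plus the EQUILATERAL glue `q^{2ρ−⌈(2ρ−m)∕2⌉}` iff `n₁ = n₂ = n₃ = m < 2ρ`, `2ρ − m ≤ m − d + 1` (MEMO v2 §4 (H)).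
[cite: Rogawski1990, §4.9 Prop. 4.9.1 (a) p. 55] [cite: Kottwitz1986BaseChangeUnits, §1 pp. 240–241] -/
theorem finsum_stabiliserWeight_hasAxis_H (hD : IsRamifiedQuadraticDatum σ ϖ d t) (h2 : Valued.v (2 : K) < 1) (hE : IsElementDatum σ ϖ N₀ α β n₁ n₂ n₃) (hN₀ : d ≤ N₀)
    (hT : (T : Matrix (Fin 3) (Fin 3) K) = Matrix.diagonal ![α, β, 1]) (ρ : ℕ) (hρ : 1 ≤ ρ) :
    ∑ᶠ M ∈ stratum σ ϖ T ![2 * ρ, 2 * ρ, 2 * ρ], stabiliserWeight σ M =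
      (if 2 * ρ ≤ min n₁ (min n₂ n₃) then (((Fintype.card 𝓀[K] : ℚ) - 2) * (Fintype.card 𝓀[K] : ℚ) ^ (2 * ρ - 1)) else 0) +
      (if n₁ = n₂ ∧ n₂ = n₃ ∧ n₁ < 2 * ρ ∧ 2 * ρ - n₁ ≤ n₁ - d + 1
        then ((Fintype.card 𝓀[K] : ℚ) ^ (2 * ρ - (2 * ρ - n₁ + 1) / 2)) else 0) := by
  have hTr := trace_bound_of_isRamifiedQuadraticDatum hD h2
  have hiso := isoceles_of_isElementDatum hD hE
  have hdmin := le_min_depth_of_isElementDatum hE hN₀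
  obtain ⟨hσ, hvσ, hϖ, hfix, hd, hd1, -⟩ := hD
  obtain ⟨hα1, hβ1, -, hαne, hβne, h₁, h₂, h₃, hN₁, hN₂, hN₃⟩ := hE
  have hα : Valued.v α = 1 := v_eq_one_of_mul_map_eq_one hvσ hα1
  have hβ : Valued.v β = 1 := v_eq_one_of_mul_map_eq_one hvσ hβ1
  have h₃' : Valued.v (β - α) = Valued.v ϖ ^ n₃ := by rw [Valuation.map_sub_swap]; exact h₃
  have hcard : (Nat.card 𝓀[K] : ℚ) = Fintype.card 𝓀[K] := by rw [Nat.card_eq_fintype_card]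
  rw [stratum_H_eq hvσ hfix hϖ T hρ]
  by_cases htube : 2 * ρ ≤ min n₁ (min n₂ n₃)
  · -- the tube (★ (C))
    rw [if_pos htube, if_neg (by omega), add_zero,
      finsum_stabiliserWeight_coreHangingStratum_tube hσ hvσ hfix hϖ hd hTr T hT hα hβ h₁ h₂ h₃' hρ (by omega) (by omega) (by omega), hcard]
  · rw [if_neg htube, zero_add]
    by_cases h12 : n₁ = n₂
    · -- the foot `n₁ = n₂ = m`
      subst h12
      by_cases hρm : ρ ≤ n₁
      · by_cases h13 : n₁ = n₃
        · -- EQUILATERAL: `m < 2ρ` from `¬htube`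
          subst h13
          have hm : n₁ < 2 * ρ := by omega
          have hαd : Valued.v (α - 1) ≤ Valued.v ϖ ^ d := by
            rw [h₂, v_varpi_pow hϖ, v_varpi_pow hϖ, WithZero.exp_le_exp]; omega
          have hβd : Valued.v (β - 1) ≤ Valued.v ϖ ^ d := by
            rw [h₁, v_varpi_pow hϖ, v_varpi_pow hϖ, WithZero.exp_le_exp]; omega
          have hg₀ : Valued.v ((β - 1) / (α - 1)) = 1 := by
            have hvϖ : 0 < Valued.v ϖ := (Valuation.pos_iff _).2 ((Valuation.ne_zero_iff Valued.v).1 (by rw [hϖ]; exact WithZero.exp_ne_zero))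
            rw [map_div₀, h₁, h₂, div_self (pow_ne_zero _ hvϖ.ne')]
          have hswitch := exists_fixed_near_glueUnit_iff_le hσ hvσ hfix hϖ hd hd1 hα1 hβ1 hαne hβne hαd hβd h₃ (by omega) (2 * ρ - n₁)
          rw [hg₀, one_mul] at hswitch
          by_cases hsw : 2 * ρ - n₁ ≤ n₁ - d + 1
          · rw [if_pos ⟨rfl, rfl, hm, hsw⟩]
            obtain ⟨f, hσf, hf⟩ := hswitch.2 hsw
            rw [finsum_stabiliserWeight_coreHangingStratum_glue hσ hvσ hfix hϖ hd hTr T hT hα hβ h₁ h₂ h₃' hρ hρm hm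
              (f₀ := -f) (by rw [map_neg, hσf]) (by rw [show -f + (β - 1) / (α - 1) = (β - 1) / (α - 1) - f by ring]; exact hf), hcard]
          · rw [if_neg (by rintro ⟨-, -, -, h⟩; exact hsw h)]
            refine finsum_stabiliserWeight_coreHangingStratum_glue_eq_zero hσ hvσ hfix hϖ hd hTr T hT hα hβ h₁ h₂ h₃' hρ hρm hm ?_
            rintro ⟨f₀, hσf₀, hf₀⟩
            exact hsw (hswitch.1 ⟨-f₀, by rw [map_neg, hσf₀], by rw [show (β - 1) / (α - 1) - -f₀ = f₀ + (β - 1) / (α - 1) by ring]; exact hf₀⟩)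
        · -- `n₃ ≠ m`: then `m < 2ρ` (isoceles) and the stratum is empty
          have hm : n₁ < 2 * ρ := by
            rcases hiso with ⟨-, h13'⟩ | ⟨h, -⟩ | ⟨h, -⟩ <;> omega
          rw [if_neg (by rintro ⟨-, h, -⟩; exact h13 h),
            coreHangingStratum_eq_empty_of_ne₃ σ hϖ T hT hα hβ h₁ h₂ h₃' hm (Ne.symm h13), finsum_mem_empty]
      · -- `m < ρ`: (S1) fails
        rw [not_le] at hρm
        rw [if_neg (by omega), coreHangingStratum_eq_empty_of_lt_rho σ hϖ T hT hα hβ h₁ h₂ h₃' hρm, finsum_mem_empty]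
    · -- off the foot, below the tube: empty
      have hlow : ¬ (2 * ρ ≤ n₁ ∧ 2 * ρ ≤ n₂) := by
        rintro ⟨ha, hb⟩
        rcases hiso with ⟨h, -⟩ | ⟨h, -⟩ | ⟨h, -⟩ <;> omega
      rw [if_neg (by rintro ⟨h, -⟩; exact h12 h), coreHangingStratum_eq_empty_of_ne σ hϖ T hT hα hβ h₁ h₂ h12 hlow, finsum_mem_empty]

end Socket

end Summit.HodgeConjecture.HodgeConjecture.Cruxes.H413.F0P3cDyRamDiagonalCoreHangingSocket

end
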